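import Summits.AnomalousDissipation.AnomalousDissipation.Theorems.UniformResolution.Negative.SteadyStates
import Summits.AnomalousDissipation.AnomalousDissipation.Theorems.CubicParityLoud.Negative.EnergyRow
import Literature.Analysis.FunctionSpaces.TorusClassicalNSUniqueness
import Literature.Analysis.FunctionSpaces.TorusTestFunction

/-!
# `MomentParity.ResolvedDissipation` (stmt-AnomalousDissipation-14284), line `enstrophy-ui-transfer`:
# the SHIFTED-ENERGY LYAPUNOV IDENTITY at a Galerkin steady state (laminar corner of the hard stub, I)

Supports stmt-AnomalousDissipation-14284 (helper of the line lead; nothing here closes an item).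

Towards the laminar corner of the hard stub U (uniform integrability of the enstrophy over admissible
laws): if the level-`N` Galerkin system at `(ν, f)` has a steady state `s` with `‖s̄‖_∞` small against `ν`,
EVERY admissible law is the Dirac mass at `s` (next file), hence U holds with `M = ‖∇s‖²`. The tool is
the stationarity row of the degree-2 observable `Σ_a ((u,e_a) − (s,e_a))²` (Galerkin frame `e_a`), whose
differential is `2(P_N u − P_N s)`, and the classical uniqueness computation (Temam 1979 Ch. II §1.4;
FMRT 2001 II (A.44)–(A.45)) run on the generator: for level-`N` `u` with representative `ū = P_N u`
and a Galerkin steady state `s` with representative `s̄`, `w̄ = ū − s̄`,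

  `⟨F(u), ū⟩ − ⟨F(u), s̄⟩ = −ν ‖∇w̄‖² + ∫⟪(w̄·∇)w̄, s̄⟫`     (`shiftedEnergy_generator_eq`).

* trilinear toolkit on smooth fields of `T³` (`b(a,c,c) = 0`, `b(a,c,e) = −b(a,e,c)`, bilinearity);
* the shifted energy polynomial `Σᵢ (Xᵢ − cᵢ)²` is written inline (no new definition);
* `polyGrad_shiftedEnergy` — the differential of the shifted energy observable is `2(ū − s̄)`;
* `shiftedEnergy_row` — admissible laws (3-stationary suffices) annihilate `⟨F(u), 2(ū − s̄)⟩`;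
* `shiftedEnergy_generator_eq` — the identity above.
-/

noncomputable section

-- `Summit.<Summit>.<Problem>`: single-conjunct summit, the duplicate namespace segment is mandated.
set_option linter.dupNamespace false

namespace Summit.AnomalousDissipation.AnomalousDissipation.Theorems.MomentParityResolvedDissipation

open MeasureTheory Filter Topology
open scoped ENNReal InnerProductSpace RealInnerProductSpace
open Literature.Analysis.FunctionSpaces Literature.Analysis.FluidPDE
open Summit.AnomalousDissipation.AnomalousDissipation.Theses.MomentParity
open Summit.AnomalousDissipation.AnomalousDissipation.Theorems.CubicParityLoud.Negative
  (T3 R3 H3 L2T3 frameG energyPoly isBandTest_frameG)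
open Summit.AnomalousDissipation.AnomalousDissipation.Theorems.QuarticGate.Negative
  (IsLevel IsBandTest polyGrad IsPolyStationary)
open Summit.AnomalousDissipation.AnomalousDissipation.Theorems.UniformResolution.Negative
  (IsGalerkinSteady coef trunc trunc_eq integrable_coe isConjSymm_coef coef_zero isBandTest_trunc
    coe_ae_eq_trunc toReal_eGradNormSq_trunc)

/-! ## Trilinear toolkit on smooth fields of `T³` -/

/-- `b(a, c, c) = 0`: `∫⟪(a·∇)c, c⟫ = 0` for smooth divergence-free `a` and smooth `c`. [folklore] -/
theorem b_self_eq_zero {a c : T3 → R3} (ha : Torus.IsSmooth a) (hdiv : Torus.IsDivFree a)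
    (hc : Torus.IsSmooth c) : ∫ x, ⟪Torus.convect a c x, c x⟫_ℝ = 0 :=
  Torus.integral_inner_convect_self_right_eq_zero ha hdiv hc

/-- `b(a, c, e) = −b(a, e, c)` for smooth divergence-free `a` and smooth `c`, `e`. [folklore] -/
theorem b_flip {a c e : T3 → R3} (ha : Torus.IsSmooth a) (hdiv : Torus.IsDivFree a)
    (hc : Torus.IsSmooth c) (he : Torus.IsSmooth e) :
    ∫ x, ⟪Torus.convect a c x, e x⟫_ℝ = -∫ x, ⟪Torus.convect a e x, c x⟫_ℝ := by
  rw [Torus.integral_inner_convect_eq_neg ha hdiv hc he]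
  congr 1
  exact integral_congr_ae (ae_of_all _ fun x => real_inner_comm _ _)

/-- `(a·∇)` is additive in the transporting field: `((a+b)·∇)c = (a·∇)c + (b·∇)c`. [folklore] -/
theorem convect_add_left (a b : T3 → R3) (c : T3 → R3) (x : T3) :
    Torus.convect (a + b) c x = Torus.convect a c x + Torus.convect b c x := by
  simp [Torus.convect, map_add]

/-- `(a·∇)` is subtractive in the transporting field: `((a−b)·∇)c = (a·∇)c − (b·∇)c`. [folklore] -/
theorem convect_sub_left (a b : T3 → R3) (c : T3 → R3) (x : T3) :
    Torus.convect (a - b) c x = Torus.convect a c x - Torus.convect b c x := by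
  simp [Torus.convect, map_sub]

/-- `(a·∇)` is subtractive in the transported field (smooth): `(a·∇)(c − e) = (a·∇)c − (a·∇)e`. [folklore] -/
theorem convect_sub_right (a : T3 → R3) {c e : T3 → R3} (hc : Torus.IsSmooth c) (he : Torus.IsSmooth e)
    (x : T3) : Torus.convect a (c - e) x = Torus.convect a c x - Torus.convect a e x := by
  simp only [Torus.convect]
  rw [Torus.fderiv_sub (hc.isContDiff (by simp)) (he.isContDiff (by simp))]
  rfl

/-- **The uniqueness rearrangement of the two trilinear terms**: for smooth divergence-free `ū`, `s̄`
with `w̄ = ū − s̄`, `−b(ū, s̄, ū) − b(s̄, ū, s̄) = b(w̄, w̄, s̄)`, i.e.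
`−∫⟪ū,(ū·∇)s̄⟫ − ∫⟪s̄,(s̄·∇)ū⟫ = ∫⟪(w̄·∇)w̄, s̄⟫` (FMRT 2001 II (A.44)–(A.45)). [folklore] -/
theorem trilinear_rearrangement {ub sb : T3 → R3} (hu : Torus.IsSmooth ub) (hudiv : Torus.IsDivFree ub)
    (hs : Torus.IsSmooth sb) (hsdiv : Torus.IsDivFree sb) :
    -(∫ x, ⟪ub x, Torus.convect ub sb x⟫_ℝ) - ∫ x, ⟪sb x, Torus.convect sb ub x⟫_ℝ =
      ∫ x, ⟪Torus.convect (ub - sb) (ub - sb) x, sb x⟫_ℝ := by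
  have hw : Torus.IsSmooth (ub - sb) := hu.sub hs
  -- expand `b(w̄, w̄, s̄)` in the first slot
  have e1 : ∀ x, ⟪Torus.convect (ub - sb) (ub - sb) x, sb x⟫_ℝ =
      ⟪Torus.convect ub (ub - sb) x, sb x⟫_ℝ - ⟪Torus.convect sb (ub - sb) x, sb x⟫_ℝ := fun x => by
    rw [convect_sub_left, inner_sub_left]
  -- and in the second slot
  have e2 : ∀ x, ⟪Torus.convect ub (ub - sb) x, sb x⟫_ℝ =
      ⟪Torus.convect ub ub x, sb x⟫_ℝ - ⟪Torus.convect ub sb x, sb x⟫_ℝ := fun x => by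
    rw [convect_sub_right ub hu hs, inner_sub_left]
  have e3 : ∀ x, ⟪Torus.convect sb (ub - sb) x, sb x⟫_ℝ =
      ⟪Torus.convect sb ub x, sb x⟫_ℝ - ⟪Torus.convect sb sb x, sb x⟫_ℝ := fun x => by
    rw [convect_sub_right sb hu hs, inner_sub_left]
  have i1 : Integrable (fun x => ⟪Torus.convect ub ub x, sb x⟫_ℝ) volume :=
    ((hu.convect hu).inner hs).integrable
  have i2 : Integrable (fun x => ⟪Torus.convect ub sb x, sb x⟫_ℝ) volume :=
    ((hu.convect hs).inner hs).integrable
  have i3 : Integrable (fun x => ⟪Torus.convect sb ub x, sb x⟫_ℝ) volume :=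
    ((hs.convect hu).inner hs).integrable
  have i4 : Integrable (fun x => ⟪Torus.convect sb sb x, sb x⟫_ℝ) volume :=
    ((hs.convect hs).inner hs).integrable
  have i12 : Integrable (fun x => ⟪Torus.convect ub ub x, sb x⟫_ℝ - ⟪Torus.convect ub sb x, sb x⟫_ℝ) volume :=
    i1.sub i2
  have i34 : Integrable (fun x => ⟪Torus.convect sb ub x, sb x⟫_ℝ - ⟪Torus.convect sb sb x, sb x⟫_ℝ) volume :=
    i3.sub i4
  have hsplit : ∫ x, ⟪Torus.convect (ub - sb) (ub - sb) x, sb x⟫_ℝ =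
      ((∫ x, ⟪Torus.convect ub ub x, sb x⟫_ℝ) - ∫ x, ⟪Torus.convect ub sb x, sb x⟫_ℝ) -
        ((∫ x, ⟪Torus.convect sb ub x, sb x⟫_ℝ) - ∫ x, ⟪Torus.convect sb sb x, sb x⟫_ℝ) := by
    simp_rw [e1, e2, e3]
    rw [integral_sub i12 i34, integral_sub i1 i2, integral_sub i3 i4]
  -- the vanishing and flipped terms
  have v2 : ∫ x, ⟪Torus.convect ub sb x, sb x⟫_ℝ = 0 := b_self_eq_zero hu hudiv hs
  have v4 : ∫ x, ⟪Torus.convect sb sb x, sb x⟫_ℝ = 0 := b_self_eq_zero hs hsdiv hs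
  have f1 : ∫ x, ⟪Torus.convect ub ub x, sb x⟫_ℝ = -∫ x, ⟪Torus.convect ub sb x, ub x⟫_ℝ :=
    b_flip hu hudiv hu hs
  -- rewrite the left-hand side in `b(·,·,·)` order
  have l1 : ∫ x, ⟪ub x, Torus.convect ub sb x⟫_ℝ = ∫ x, ⟪Torus.convect ub sb x, ub x⟫_ℝ :=
    integral_congr_ae (ae_of_all _ fun x => real_inner_comm _ _)
  have l2 : ∫ x, ⟪sb x, Torus.convect sb ub x⟫_ℝ = ∫ x, ⟪Torus.convect sb ub x, sb x⟫_ℝ :=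
    integral_congr_ae (ae_of_all _ fun x => real_inner_comm _ _)
  rw [hsplit, v2, v4, f1, l1, l2]
  ring

/-! ## The shifted energy observable and its row -/

/-- `Σ (Xᵢ − cᵢ)²` has total degree `≤ 2` (an admissible test at order 3). [folklore] -/
theorem totalDegree_shiftedEnergyPoly {n : ℕ} (c : Fin n → ℝ) :
    (∑ i : Fin n, (MvPolynomial.X i - MvPolynomial.C (c i)) ^ 2 : MvPolynomial (Fin n) ℝ).totalDegree + 1 ≤ 3 := by
  have : (∑ i : Fin n, (MvPolynomial.X i - MvPolynomial.C (c i)) ^ 2 : MvPolynomial (Fin n) ℝ).totalDegree ≤ 2 := by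
    refine (MvPolynomial.totalDegree_finsetSum _ _).trans (Finset.sup_le fun i _ => ?_)
    refine (MvPolynomial.totalDegree_pow _ _).trans ?_
    have h1 : (MvPolynomial.X i - MvPolynomial.C (c i) : MvPolynomial (Fin n) ℝ).totalDegree ≤ 1 := by
      refine (MvPolynomial.totalDegree_sub _ _).trans (max_le ?_ ?_)
      · rw [MvPolynomial.totalDegree_X]
      · rw [MvPolynomial.totalDegree_C]; exact zero_le_one
    omega
  omega

/-- `∂ᵢ Σⱼ (Xⱼ − cⱼ)² = 2(Xᵢ − cᵢ)`, evaluated. [folklore] -/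
theorem eval_pderiv_shiftedEnergyPoly {n : ℕ} (c v : Fin n → ℝ) (i : Fin n) :
    MvPolynomial.eval v (MvPolynomial.pderiv i
      (∑ j : Fin n, (MvPolynomial.X j - MvPolynomial.C (c j)) ^ 2 : MvPolynomial (Fin n) ℝ)) =
      2 * (v i - c i) := by
  simp [map_sum, Derivation.leibniz_pow, MvPolynomial.pderiv_X, Pi.single_apply,
    Finset.sum_ite_eq', mul_comm]

/-- The Galerkin frame reproduces the truncation: `Σ_a (v, e_a) e_a = P_N v` for `v ∈ H`
(`Torus.sum_integral_inner_frameField_smul` re-indexed over `frameG`). [folklore] -/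
theorem sum_pairing_frameG_smul (N : ℕ) (v : H3) (x : T3) :
    ∑ i, Torus.pairing v.1 (frameG N i) • frameG N i x = trunc N v x := by
  have h := Torus.sum_galerkinTest_eq (d := Fin 3) N one_pos (fun g => Torus.pairing v.1 g • g x)
  change ∑ i, Torus.pairing v.1 ((Torus.galerkinTest (d := Fin 3) N one_pos).g i) •
      (Torus.galerkinTest (d := Fin 3) N one_pos).g i x = _
  rw [h]
  exact Torus.sum_integral_inner_frameField_smul v.2 N x

/-- **The differential of the shifted energy observable is `2(P_N u − P_N s)`**: with shifts
`c_a = (s, e_a)` over the Galerkin frame of level `N`, `∇p(u) = Σ_a 2((u,e_a) − (s,e_a)) e_a = 2(ū − s̄)`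
for all `u, s ∈ H` (the frame reproduces truncations, `Torus.sum_integral_inner_frameField_smul`). [folklore] -/
theorem polyGrad_shiftedEnergy (N : ℕ) (u s : H3) :
    polyGrad (frameG N) (∑ a, (MvPolynomial.X a - MvPolynomial.C (Torus.pairing s.1 (frameG N a))) ^ 2) u =
      fun x => (2 : ℝ) • (trunc N u x - trunc N s x) := by
  funext x
  simp only [polyGrad, eval_pderiv_shiftedEnergyPoly, mul_smul]
  rw [← Finset.smul_sum]
  congr 1
  simp_rw [sub_smul]
  rw [Finset.sum_sub_distrib, sum_pairing_frameG_smul N u x, sum_pairing_frameG_smul N s x]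

/-- **The shifted-energy row.** A finite law on `H` which is 3-stationary for Galerkin NS at `(ν, f)`
and level `N` (the crux's stationarity clause at order `d = 3` suffices) annihilates the generator tested
against `2(ū − s̄)` for EVERY `s ∈ H` (integrable row, zero mean). [folklore] -/
theorem shiftedEnergy_row {ν : ℝ} {f : T3 → R3} {N : ℕ} {μ : Measure H3}
    (hS : IsPolyStationary ν f N 3 μ) (s : H3) :
    Integrable (fun u : H3 => Torus.nsGeneratorPairing ν f u
        (fun x => (2 : ℝ) • (trunc N u x - trunc N s x))) μ ∧
      ∫ u, Torus.nsGeneratorPairing ν f u (fun x => (2 : ℝ) • (trunc N u x - trunc N s x)) ∂μ = 0 := by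
  obtain ⟨hI, h0⟩ := hS _ (frameG N) (∑ a, (MvPolynomial.X a - MvPolynomial.C (Torus.pairing s.1 (frameG N a))) ^ 2)
    (isBandTest_frameG N) (totalDegree_shiftedEnergyPoly _)
  simp_rw [polyGrad_shiftedEnergy N _ s] at hI h0
  exact ⟨hI, h0⟩

/-! ## The generator against `2(ū − s̄)`: the Lyapunov identity -/

/-- Linearity: `⟨F(u), 2(ū − s̄)⟩ = 2(⟨F(u), ū⟩ − ⟨F(u), s̄⟩)`. [folklore] -/
theorem nsGeneratorPairing_two_smul_sub (ν : ℝ) {f : T3 → R3} (hf : Torus.IsSmooth f) (N : ℕ) (u s : H3) :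
    Torus.nsGeneratorPairing ν f u (fun x => (2 : ℝ) • (trunc N u x - trunc N s x)) =
      2 * (Torus.nsGeneratorPairing ν f u (trunc N u) - Torus.nsGeneratorPairing ν f u (trunc N s)) := by
  have hU : Torus.IsSmooth (trunc N u) := Torus.isSmooth_fourierTruncate N ((u.1 : L2T3) : T3 → R3)
  have hSm : Torus.IsSmooth (trunc N s) := Torus.isSmooth_fourierTruncate N ((s.1 : L2T3) : T3 → R3)
  set g : Bool → T3 → R3 := fun b => Bool.rec (motive := fun _ => T3 → R3) (trunc N s) (trunc N u) b with hg
  have hsm : ∀ b ∈ (Finset.univ : Finset Bool), Torus.IsSmooth (g b) := by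
    rintro (_ | _) -
    · exact hSm
    · exact hU
  have h := Torus.nsGeneratorPairing_sum_smul ν hf.integrable u Finset.univ
    (fun b : Bool => Bool.rec (motive := fun _ => ℝ) (-2) 2 b) hsm
  have e : (fun x => ∑ b ∈ (Finset.univ : Finset Bool), (Bool.rec (motive := fun _ => ℝ) (-2) 2 b) • g b x) =
      fun x => (2 : ℝ) • (trunc N u x - trunc N s x) := by
    funext x
    rw [Fintype.sum_bool]
    simp only [hg, smul_sub, neg_smul]
    abel
  rw [e] at h
  rw [h, Fintype.sum_bool]
  simp only [hg]
  ring

/-- **THE SHIFTED-ENERGY LYAPUNOV IDENTITY at a Galerkin steady state.** Let `u ∈ H` be level-`N` with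
representative `ū = P_N u`, and let `s ∈ H` be a level-`N` Galerkin steady state at `(ν, f)` (every
level-`N` band test annihilates `⟨F(s), ·⟩`) with representative `s̄ = P_N s`; put `w̄ = ū − s̄`. Then
`⟨F(u), ū⟩ − ⟨F(u), s̄⟩ = −ν ‖∇w̄‖² + ∫⟪(w̄·∇)w̄, s̄⟫` (`‖∇w̄‖² = −∫⟪w̄, Δw̄⟫`).
Proof: generator = flux on the representative (`Torus.nsGeneratorPairing_eq_flux`), the two Galerkin
equations of `s` tested with `ū` and `s̄`, symmetry of `∫⟪·, Δ·⟫`, `b(a,a,a) = 0` and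
`trilinear_rearrangement`. This is Temam's uniqueness computation for steady states, run on the
generator of the Galerkin dynamics. [cite: Temam1979, Ch. II Thm. 1.3 (uniqueness for small data)] -/
theorem shiftedEnergy_generator_eq :
    ∀ (ν : ℝ) (f : T3 → R3), Torus.IsSmooth f → ∀ (N : ℕ) (u s : H3),
    IsLevel N u → IsLevel N s → IsGalerkinSteady ν f N s →
    Torus.nsGeneratorPairing ν f u (trunc N u) - Torus.nsGeneratorPairing ν f u (trunc N s) =
      ν * (∫ x, ⟪trunc N u x - trunc N s x, Torus.laplacian (trunc N u - trunc N s) x⟫_ℝ) +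
        ∫ x, ⟪Torus.convect (trunc N u - trunc N s) (trunc N u - trunc N s) x, trunc N s x⟫_ℝ := by
  intro ν f hf N u s hu hs hst
  -- smoothness / solenoidality of the representatives
  have hU : Torus.IsSmooth (trunc N u) := Torus.isSmooth_fourierTruncate N ((u.1 : L2T3) : T3 → R3)
  have hSm : Torus.IsSmooth (trunc N s) := Torus.isSmooth_fourierTruncate N ((s.1 : L2T3) : T3 → R3)
  have hUdiv : Torus.IsDivFree (trunc N u) := (isBandTest_trunc u).2.1
  have hSdiv : Torus.IsDivFree (trunc N s) := (isBandTest_trunc s).2.1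
  have hW : Torus.IsSmooth (trunc N u - trunc N s) := hU.sub hSm
  -- flux forms for `u` (representative `ū`) against `ū` and `s̄`
  have hf2 : MemLp f 2 volume := hf.memLp 2
  have Fu := Torus.nsGeneratorPairing_eq_flux ν hf2 hU (coe_ae_eq_trunc u hu)
  have Fs := Torus.nsGeneratorPairing_eq_flux ν hf2 hSm (coe_ae_eq_trunc u hu)
  -- the Galerkin equations of `s` (representative `s̄`) tested with `ū` and `s̄`
  have Gu : (∫ x, (⟪trunc N s x, Torus.convect (trunc N s) (trunc N u) x⟫_ℝ +
      ν * ⟪trunc N s x, Torus.laplacian (trunc N u) x⟫_ℝ + ⟪f x, trunc N u x⟫_ℝ)) = 0 := by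
    rw [← Torus.nsGeneratorPairing_eq_flux ν hf2 hU (coe_ae_eq_trunc s hs)]
    exact hst _ (isBandTest_trunc u)
  have Gs : (∫ x, (⟪trunc N s x, Torus.convect (trunc N s) (trunc N s) x⟫_ℝ +
      ν * ⟪trunc N s x, Torus.laplacian (trunc N s) x⟫_ℝ + ⟪f x, trunc N s x⟫_ℝ)) = 0 := by
    rw [← Torus.nsGeneratorPairing_eq_flux ν hf2 hSm (coe_ae_eq_trunc s hs)]
    exact hst _ (isBandTest_trunc s)
  -- split all flux integrals into their three summands
  have spl : ∀ {a g : T3 → R3}, Torus.IsSmooth a → Torus.IsSmooth g →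
      (∫ x, (⟪a x, Torus.convect a g x⟫_ℝ + ν * ⟪a x, Torus.laplacian g x⟫_ℝ + ⟪f x, g x⟫_ℝ)) =
        (∫ x, ⟪a x, Torus.convect a g x⟫_ℝ) + ν * (∫ x, ⟪a x, Torus.laplacian g x⟫_ℝ) +
          ∫ x, ⟪f x, g x⟫_ℝ := by
    intro a g ha hg
    have i1 : Integrable (fun x => ⟪a x, Torus.convect a g x⟫_ℝ) volume := (ha.inner (ha.convect hg)).integrable
    have i2 : Integrable (fun x => ν * ⟪a x, Torus.laplacian g x⟫_ℝ) volume :=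
      ((ha.inner hg.laplacian).integrable).const_mul ν
    have i3 : Integrable (fun x => ⟪f x, g x⟫_ℝ) volume := (hf.inner hg).integrable
    have i12 : Integrable (fun x => ⟪a x, Torus.convect a g x⟫_ℝ + ν * ⟪a x, Torus.laplacian g x⟫_ℝ) volume :=
      i1.add i2
    rw [integral_add i12 i3, integral_add i1 i2, integral_const_mul]
  rw [spl hU hU] at Fu
  rw [spl hU hSm] at Fs
  rw [spl hSm hU] at Gu
  rw [spl hSm hSm] at Gs
  -- `b(ū,ū,ū) = 0`, `b(s̄,s̄,s̄) = 0`
  have T1 : ∫ x, ⟪trunc N u x, Torus.convect (trunc N u) (trunc N u) x⟫_ℝ = 0 := by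
    rw [integral_congr_ae (ae_of_all _ fun x => real_inner_comm _ _)]
    exact b_self_eq_zero hU hUdiv hU
  have T2 : ∫ x, ⟪trunc N s x, Torus.convect (trunc N s) (trunc N s) x⟫_ℝ = 0 := by
    rw [integral_congr_ae (ae_of_all _ fun x => real_inner_comm _ _)]
    exact b_self_eq_zero hSm hSdiv hSm
  -- symmetry of the Laplacian pairing
  have L1 : ∫ x, ⟪trunc N s x, Torus.laplacian (trunc N u) x⟫_ℝ =
      ∫ x, ⟪trunc N u x, Torus.laplacian (trunc N s) x⟫_ℝ := by
    rw [← Torus.integral_inner_laplacian_comm hSm hU]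
    exact integral_congr_ae (ae_of_all _ fun x => real_inner_comm _ _)
  -- the Laplacian pairing of the difference
  have iUU : Integrable (fun x => ⟪trunc N u x, Torus.laplacian (trunc N u) x⟫_ℝ) volume :=
    (hU.inner hU.laplacian).integrable
  have iUS : Integrable (fun x => ⟪trunc N u x, Torus.laplacian (trunc N s) x⟫_ℝ) volume :=
    (hU.inner hSm.laplacian).integrable
  have iSU : Integrable (fun x => ⟪trunc N s x, Torus.laplacian (trunc N u) x⟫_ℝ) volume :=
    (hSm.inner hU.laplacian).integrable
  have iSS : Integrable (fun x => ⟪trunc N s x, Torus.laplacian (trunc N s) x⟫_ℝ) volume :=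
    (hSm.inner hSm.laplacian).integrable
  have LW : ∫ x, ⟪trunc N u x - trunc N s x, Torus.laplacian (trunc N u - trunc N s) x⟫_ℝ =
      ((∫ x, ⟪trunc N u x, Torus.laplacian (trunc N u) x⟫_ℝ) - ∫ x, ⟪trunc N u x, Torus.laplacian (trunc N s) x⟫_ℝ) -
        ((∫ x, ⟪trunc N s x, Torus.laplacian (trunc N u) x⟫_ℝ) - ∫ x, ⟪trunc N s x, Torus.laplacian (trunc N s) x⟫_ℝ) := by
    have e : ∀ x, ⟪trunc N u x - trunc N s x, Torus.laplacian (trunc N u - trunc N s) x⟫_ℝ =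
        (⟪trunc N u x, Torus.laplacian (trunc N u) x⟫_ℝ - ⟪trunc N u x, Torus.laplacian (trunc N s) x⟫_ℝ) -
          (⟪trunc N s x, Torus.laplacian (trunc N u) x⟫_ℝ - ⟪trunc N s x, Torus.laplacian (trunc N s) x⟫_ℝ) := by
      intro x
      rw [Torus.laplacian_sub hU hSm, Pi.sub_apply, inner_sub_left, inner_sub_right, inner_sub_right]
    have iA : Integrable (fun x => ⟪trunc N u x, Torus.laplacian (trunc N u) x⟫_ℝ -
        ⟪trunc N u x, Torus.laplacian (trunc N s) x⟫_ℝ) volume := iUU.sub iUS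
    have iB : Integrable (fun x => ⟪trunc N s x, Torus.laplacian (trunc N u) x⟫_ℝ -
        ⟪trunc N s x, Torus.laplacian (trunc N s) x⟫_ℝ) volume := iSU.sub iSS
    simp_rw [e]
    rw [integral_sub iA iB, integral_sub iUU iUS, integral_sub iSU iSS]
  -- the trilinear rearrangement
  have TR := trilinear_rearrangement hU hUdiv hSm hSdiv
  -- assemble
  rw [Fu, Fs, LW, ← TR, T1]
  rw [T2] at Gs
  have Gu' : ∫ x, ⟪f x, trunc N u x⟫_ℝ =
      -(∫ x, ⟪trunc N s x, Torus.convect (trunc N s) (trunc N u) x⟫_ℝ) -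
        ν * ∫ x, ⟪trunc N s x, Torus.laplacian (trunc N u) x⟫_ℝ := by linarith
  have Gs' : ∫ x, ⟪f x, trunc N s x⟫_ℝ = -(ν * ∫ x, ⟪trunc N s x, Torus.laplacian (trunc N s) x⟫_ℝ) := by
    linarith
  rw [Gu', Gs', L1]
  ring

end Summit.AnomalousDissipation.AnomalousDissipation.Theorems.MomentParityResolvedDissipation

end
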